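import Summits.BirchSwinnertonDyer.BirchSwinnertonDyer.Theorems.GenusKolyvaginAtTwoEquivariantKolyvaginExactAtTwoEigenClassesFinite
import Summits.BirchSwinnertonDyer.BirchSwinnertonDyer.Theorems.GenusKolyvaginAtTwoVisiblePairAtTwoDefs
import HarnessLib

/-!
# Route `GenusKolyvaginAtTwo`, LINE 13, crux U `ShaCardDvdPowAtTwoR` (stmt-BirchSwinnertonDyer-28029):
# the ENTANGLEMENT LEMMA of the `ℚ`-pair frame at `2` — a pair of classes tied over `K` is a pair of
# `2`-torsion classes (Lawson–Wuthrich-free), and the habitat condition (H2′) modulo two displayed inputs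

Seat `bsd-line-gk2-p3` g14 (cell `bsd-f1-sign2`), `--supports stmt-BirchSwinnertonDyer-28029` (helper; closes nothing).
THEOREMS ONLY (no definition, no named fact, no `sorry`); BSD is not proved by any of this.

Kolyvagin's frame for the pair `(E, E^{(c)})` over `ℚ` (Izv. 1989 §3; the tree's `KolyvaginDescent.VisiblePairHypothesesM`
and its instance `GenusExact.VisiblePairAtTwo.Input`) reads the two members in `H¹(K, E_K[n])` through
`res : H¹(ℚ, E[n]) → H¹(K, E_K[n])⁺` and `hPsiKT ∘ res : H¹(ℚ, E^{(c)}[n]) → H¹(K, E_K[n])⁻` (`K = ℚ(θ)`, `θ² = c`;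
`…EigenClassesFinite`).  At `n = 2^M` the two images MEET: `H⁺ ∩ H⁻ = H⁺[2]` — the "entanglement of bottom bits" that
makes the habitat condition (H2) `sel_visible` fail (`…H2Vacuity`, seat g13).  This file proves the converse bound,
which is the algebraic core of the repaired condition (H2′) proposed there:

* §1 `two_zsmul_eq_zero_of_resTorsion_add_hPsiKT_eq_zero` — for ANY quadratic `K = ℚ(θ)` and any level `n`: if
  `res u + hPsiKT (res w) = 0` in `H¹(K, E_K[n])` then `2 · res u = 0` and `2 · hPsiKT (res w) = 0` (apply the
  conjugation `σ₀`: it fixes `res u` — `conjAct_resTorsion` — and negates `hPsiKT (res w)` — `conjAct_hPsiKT`); hence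
  `2 · (2u) = 0`, `2 · (2w) = 0` unconditionally (`two_nsmul_eq_zero_of_resTorsion_eq_zero`: the kernel of `res` is
  killed by `2`), and **`2u = 0`, `2w = 0` when `E(K)[n] = 0`** (`resTorsion_injective_of_noTorsion`), in particular
  on the habitat `ρ̄_{E,2}` onto, `n = 2^M` (`two_zsmul_eq_zero_of_entangled_of_hasSurjectiveModNGaloisRep_two`).
  No Galois cohomology of `K(E[2^M])/K` enters (Lawson–Wuthrich-free).
* §2 `two_zsmul_eq_zero_of_rK₁_add_rK₂_eq_zero` — the same conclusion from the WEAKER tie `rK₁ u + rK₂ w = 0` of the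
  instance (`…VisiblePairAtTwoDefs`: vanishing of all evaluations on `Γ_{K(E_K[2^M])}`), MODULO the two honest inputs
  it needs, displayed as hypotheses on the inflation kernel `N = {y : ∀ ρ ∈ Γ_{K(E[2^M])}, [y, ρ] = 0}`:
  (`hNfix`) `σ₀` acts trivially on `N` (true when `K ∩ ℚ(E[2^M]) = ℚ`: the lift of `σ₀` fixing `ℚ(E[2^M])` centralises
  `Gal(K(E[2^M])/K)` and fixes the coefficients) and (`hN2`) `2 N = 0` (Lawson–Wuthrich 2016:
  `H¹(GL₂(ℤ/2^M), (ℤ/2^M)²) ≅ ℤ/2` for `M ≥ 2`, `0` for `M = 1`).  This is (H2′) of the g13 finding in kernel form.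

References: [Kolyvagin1989Izv] §3; [GrossLMS1991] §5 (5.1); [McCallumLMS1991] p. 299; [LawsonWuthrich2016] §7.1, §8;
[Dokchitser2013ParityNotes] §4.
-/

set_option autoImplicit false
set_option linter.dupNamespace false -- tree convention: `Summit.BirchSwinnertonDyer.BirchSwinnertonDyer.Theorems` (summit = sub-problem)

noncomputable section

open scoped Classical

namespace Summit.BirchSwinnertonDyer.BirchSwinnertonDyer.Theorems.GenusExact.VisiblePairAtTwo

open WeierstrassCurve NumberField Field
open Literature.NumberTheory.EllipticCurves Literature.NumberTheory.GaloisRepresentations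
open Summit.BirchSwinnertonDyer.BirchSwinnertonDyer.Theorems.GenusExact.EigenClassesFinite

/-! ## §1 Entangled pairs are `2`-torsion pairs -/

section General

variable (W : WeierstrassCurve ℚ) (K : Type) [Field K] [NumberField K] (h2 : Module.finrank ℚ K = 2)
  {θ : K} {c : ℚ} (hθ : θ ∉ Set.range (algebraMap ℚ K)) (hc : θ ^ 2 = algebraMap ℚ K c) (n : ℤ)

include h2 in
/-- **A pair tied over `K` is tied in `2`-torsion.** For `u ∈ H¹(ℚ, E[n])`, `w ∈ H¹(ℚ, E^{(c)}[n])` with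
`res u + hPsiKT (res w) = 0` in `H¹(K, E_K[n])`: `2 · res u = 0` and `2 · hPsiKT (res w) = 0` (`σ₀` fixes the first
summand and negates the second, so `res u − hPsiKT (res w) = 0` as well). [cite: GrossLMS1991, §5 (5.1)]
[cite: Kolyvagin1989Izv, §3] -/
theorem two_zsmul_eq_zero_of_resTorsion_add_hPsiKT_eq_zero (u : galH1Torsion W n)
    (w : galH1Torsion (W.quadraticTwist c) n)
    (h : resTorsion W K n u + hPsiKT W K hθ hc n (resTorsion (W.quadraticTwist c) K n w) = 0) :
    (2 : ℤ) • resTorsion W K n u = 0 ∧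
      (2 : ℤ) • hPsiKT W K hθ hc n (resTorsion (W.quadraticTwist c) K n w) = 0 := by
  haveI : IsGalois ℚ K := isGalois_of_finrank_eq_two K h2
  have hσ₀ : sigmaQ K h2 hθ hc ≠ 1 := sigmaQ_ne_one K h2 hθ hc
  -- `σ₀ a = a`, `σ₀ b = -b`
  have hτa : conjAct W (sigmaQ K h2 hθ hc) n (resTorsion W K n u) = resTorsion W K n u :=
    conjAct_resTorsion K W n (sigmaQ K h2 hθ hc) h2 hσ₀ u
  have hτb : conjAct W (sigmaQ K h2 hθ hc) n (hPsiKT W K hθ hc n (resTorsion (W.quadraticTwist c) K n w)) =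
      -(hPsiKT W K hθ hc n (resTorsion (W.quadraticTwist c) K n w)) := by
    rw [conjAct_hPsiKT W K h2 hθ hc n, conjAct_resTorsion K (W.quadraticTwist c) n (sigmaQ K h2 hθ hc) h2 hσ₀ w]
  -- apply `σ₀` to `a + b = 0`: `a - b = 0`
  have hdiff : resTorsion W K n u - hPsiKT W K hθ hc n (resTorsion (W.quadraticTwist c) K n w) = 0 := by
    have h' := congrArg (conjAct W (sigmaQ K h2 hθ hc) n) h
    rw [map_add, map_zero, hτa, hτb, ← sub_eq_add_neg] at h'
    exact h'
  have hsum := h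
  constructor
  · -- `2a = (a + b) + (a - b)`
    have e : (2 : ℤ) • resTorsion W K n u =
        (resTorsion W K n u + hPsiKT W K hθ hc n (resTorsion (W.quadraticTwist c) K n w)) +
          (resTorsion W K n u - hPsiKT W K hθ hc n (resTorsion (W.quadraticTwist c) K n w)) := by
      rw [two_zsmul, add_add_sub_cancel]
    rw [e, hsum, hdiff, add_zero]
  · -- `2b = (a + b) - (a - b)`
    have e : (2 : ℤ) • hPsiKT W K hθ hc n (resTorsion (W.quadraticTwist c) K n w) =
        (resTorsion W K n u + hPsiKT W K hθ hc n (resTorsion (W.quadraticTwist c) K n w)) -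
          (resTorsion W K n u - hPsiKT W K hθ hc n (resTorsion (W.quadraticTwist c) K n w)) := by
      rw [two_zsmul, add_sub_sub_cancel]
    rw [e, hsum, hdiff, sub_zero]

include h2 in
/-- **Unconditionally the tied classes are killed by `2 · 2` over `ℚ`**: the kernel of
`res : H¹(ℚ, ·[n]) → H¹(K, ·[n])` is killed by `2` for a quadratic `K` (`two_nsmul_eq_zero_of_resTorsion_eq_zero`).
[cite: SerreGaloisCohomology1997, I §2.4 Prop. 9] -/
theorem two_nsmul_two_zsmul_eq_zero_of_resTorsion_add_hPsiKT_eq_zero (u : galH1Torsion W n)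
    (w : galH1Torsion (W.quadraticTwist c) n)
    (h : resTorsion W K n u + hPsiKT W K hθ hc n (resTorsion (W.quadraticTwist c) K n w) = 0) :
    2 • ((2 : ℤ) • u) = 0 ∧ 2 • ((2 : ℤ) • w) = 0 := by
  haveI : IsGalois ℚ K := isGalois_of_finrank_eq_two K h2
  have hσ₀ : sigmaQ K h2 hθ hc ≠ 1 := sigmaQ_ne_one K h2 hθ hc
  obtain ⟨ha, hb⟩ := two_zsmul_eq_zero_of_resTorsion_add_hPsiKT_eq_zero W K h2 hθ hc n u w h
  have hu : resTorsion W K n ((2 : ℤ) • u) = 0 := by rw [map_zsmul, ha]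
  have hw : resTorsion (W.quadraticTwist c) K n ((2 : ℤ) • w) = 0 := by
    apply (hPsiKT W K hθ hc n).injective
    rw [map_zsmul, map_zsmul, hb, map_zero]
  exact ⟨two_nsmul_eq_zero_of_resTorsion_eq_zero K W n (sigmaQ K h2 hθ hc) h2 hσ₀ hu,
    two_nsmul_eq_zero_of_resTorsion_eq_zero K (W.quadraticTwist c) n (sigmaQ K h2 hθ hc) h2 hσ₀ hw⟩

include h2 in
/-- **With `E(K)[n] = 0` the tied classes are `2`-torsion over `ℚ`** (`res` and `hPsiKT ∘ res` are then injective,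
`…EigenClassesFinite`): `res u + hPsiKT (res w) = 0 ⟹ 2u = 0 ∧ 2w = 0`. [cite: GrossLMS1991, §5 (5.1)]
[cite: Kolyvagin1989Izv, §3] -/
theorem two_zsmul_eq_zero_of_entangled (hL : ∀ P : (W.baseChange K).toAffine.Point, n • P = 0 → P = 0)
    (u : galH1Torsion W n) (w : galH1Torsion (W.quadraticTwist c) n)
    (h : resTorsion W K n u + hPsiKT W K hθ hc n (resTorsion (W.quadraticTwist c) K n w) = 0) :
    (2 : ℤ) • u = 0 ∧ (2 : ℤ) • w = 0 := by
  obtain ⟨ha, hb⟩ := two_zsmul_eq_zero_of_resTorsion_add_hPsiKT_eq_zero W K h2 hθ hc n u w h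
  have hu : resTorsion W K n ((2 : ℤ) • u) = resTorsion W K n 0 := by rw [map_zsmul, map_zero, ha]
  have hw : resTorsion (W.quadraticTwist c) K n ((2 : ℤ) • w) = resTorsion (W.quadraticTwist c) K n 0 := by
    apply (hPsiKT W K hθ hc n).injective
    rw [map_zsmul, map_zsmul, hb, map_zero, map_zero]
  exact ⟨resTorsion_injective_of_noTorsion W K h2 hθ hc n hL hu,
    resTorsion_twist_injective_of_noTorsion W K h2 hθ hc n hL hw⟩

include h2 in
/-- **The intersection `H⁺ ∩ H⁻` is `2`-torsion**: a class of `H¹(K, E_K[n])` that is both a restricted class of `E`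
and a (twisted) restricted class of `E^{(c)}` is killed by `2`. [cite: GrossLMS1991, §5 (5.1)] -/
theorem two_zsmul_eq_zero_of_mem_range_of_mem_range {y : galH1Torsion (W.baseChange K) n}
    (hy₁ : y ∈ (resTorsion W K n).range)
    (hy₂ : ∃ w : galH1Torsion (W.quadraticTwist c) n,
      hPsiKT W K hθ hc n (resTorsion (W.quadraticTwist c) K n w) = y) :
    (2 : ℤ) • y = 0 := by
  obtain ⟨u, rfl⟩ := hy₁
  obtain ⟨w, hw⟩ := hy₂
  have h : resTorsion W K n u + hPsiKT W K hθ hc n (resTorsion (W.quadraticTwist c) K n (-w)) = 0 := by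
    rw [map_neg, map_neg, hw, add_neg_cancel]
  exact (two_zsmul_eq_zero_of_resTorsion_add_hPsiKT_eq_zero W K h2 hθ hc n u (-w) h).1

end General

/-! ## §1′ The habitat: `ρ̄_{E,2}` onto, level `2^M`, twin by `d_K` -/

section Habitat

variable (W : WeierstrassCurve ℚ) [W.IsElliptic] (K : Type) [Field K] [NumberField K] (M : ℕ)
  (h2 : Module.finrank ℚ K = 2) {θ : K} (hθ : θ ∉ Set.range (algebraMap ℚ K))
  (hθsq : θ ^ 2 = algebraMap ℚ K ((NumberField.discr K : ℤ) : ℚ))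

include h2 in
/-- **Entangled Selmer pairs of the instance are `2`-torsion pairs** (habitat `ρ̄_{E,2}` onto, `K = ℚ(θ)`, `θ² = d_K`,
level `2^M`): for `s₁ ∈ H¹(ℚ, E[2^M])`, `s₂ ∈ H¹(ℚ, E^{(d_K)}[2^M])` with `res s₁ + hPsiKT (res s₂) = 0`,
`2 s₁ = 0` and `2 s₂ = 0` — the exact converse of `…H2Vacuity.exists_selmer_twin_rK₁_add_rK₂_eq_zero` (which ties
every `2`-torsion Selmer class).  So a repaired habitat condition can only ask for `2 s₁ = 0 ∧ 2 s₂ = 0` (H2′), never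
for `s₁ = 0 ∧ s₂ = 0` (H2). [cite: Kolyvagin1989Izv, §3] [cite: McCallumLMS1991, p. 299] -/
theorem two_zsmul_eq_zero_of_entangled_of_hasSurjectiveModNGaloisRep_two (hs : W.HasSurjectiveModNGaloisRep 2)
    (s₁ : galH1Torsion W (lvl M)) (s₂ : galH1Torsion (twin W K) (lvl M))
    (h : resTorsion W K (lvl M) s₁ + hPsiKT W K hθ hθsq (lvl M) (resTorsion (twin W K) K (lvl M) s₂) = 0) :
    (2 : ℤ) • s₁ = 0 ∧ (2 : ℤ) • s₂ = 0 :=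
  two_zsmul_eq_zero_of_entangled W K h2 hθ hθsq (lvl M)
    (forall_zsmul_two_pow_baseChange_eq_zero_of_hasSurjectiveModNGaloisRep_two W K h2 hs M) s₁ s₂ h

end Habitat

/-! ## §2 (H2′) from the tie in `H`, modulo the two inputs on the inflation kernel -/

section Visible

variable (W : WeierstrassCurve ℚ) [W.IsElliptic] (K : Type) [Field K] [NumberField K] (M : ℕ)
  (h2 : Module.finrank ℚ K = 2) {θ : K} (hθ : θ ∉ Set.range (algebraMap ℚ K))
  (hθsq : θ ^ 2 = algebraMap ℚ K ((NumberField.discr K : ℤ) : ℚ))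

/-- **(H2′) modulo its two inputs.**  Let `N ≤ H¹(K, E_K[2^M])` be the classes all of whose evaluations on
`Γ_{K(E_K[2^M])}` vanish (the inflation of `H¹(K(E[2^M])/K, E[2^M])`).  ASSUME (`hNfix`) `σ₀` acts trivially on `N`
and (`hN2`) `2 N = 0`.  Then for `s₁ ∈ H¹(ℚ, E[2^M])`, `s₂ ∈ H¹(ℚ, E^{(d_K)}[2^M])` with `rK₁ s₁ + rK₂ s₂ = 0` (the tie
SEEN IN `H`, as in `Input.sel_visible`): `2 s₁ = 0 ∧ 2 s₂ = 0` on the habitat `ρ̄_{E,2}` onto.  Proof: `z = res s₁ +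
hPsiKT (res s₂) ∈ N`; `σ₀ z = res s₁ − hPsiKT (res s₂)` equals `z` by `hNfix`, so `2 hPsiKT (res s₂) = 0`; `2z = 0` by
`hN2`, so `2 res s₁ = 0`; conclude by injectivity (`E(K)[2^M] = 0`). [cite: McCallumLMS1991, p. 299]
[cite: LawsonWuthrich2016, §7.1 and §8] [cite: GrossLMS1991, §5 (5.1)] -/
theorem two_zsmul_eq_zero_of_rK₁_add_rK₂_eq_zero (hs : W.HasSurjectiveModNGaloisRep 2)
    (hNfix : ∀ y : galH1Torsion (W.baseChange K) (lvl M),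
      (∀ ρ : torsionFixing (W.baseChange K) (lvl M), h1Eval (W.baseChange K) (lvl M) y ρ = 0) →
        conjAct W (sigmaQ K h2 hθ hθsq) (lvl M) y = y)
    (hN2 : ∀ y : galH1Torsion (W.baseChange K) (lvl M),
      (∀ ρ : torsionFixing (W.baseChange K) (lvl M), h1Eval (W.baseChange K) (lvl M) y ρ = 0) →
        (2 : ℤ) • y = 0)
    (s₁ : galH1Torsion W (lvl M)) (s₂ : galH1Torsion (twin W K) (lvl M))
    (h : rK₁ W K M s₁ + rK₂ W M hθ hθsq s₂ = 0) :
    (2 : ℤ) • s₁ = 0 ∧ (2 : ℤ) • s₂ = 0 := by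
  haveI : IsGalois ℚ K := isGalois_of_finrank_eq_two K h2
  have hσ₀ : sigmaQ K h2 hθ hθsq ≠ 1 := sigmaQ_ne_one K h2 hθ hθsq
  have hL := forall_zsmul_two_pow_baseChange_eq_zero_of_hasSurjectiveModNGaloisRep_two W K h2 hs M
  obtain ⟨a, ha⟩ : ∃ a, a = resTorsion W K (lvl M) s₁ := ⟨_, rfl⟩
  obtain ⟨b, hb⟩ : ∃ b, b = hPsiKT W K hθ hθsq (lvl M) (resTorsion (twin W K) K (lvl M) s₂) := ⟨_, rfl⟩
  -- the tie in `H`: every evaluation of `z = a + b` vanishes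
  have hz : ∀ ρ : torsionFixing (W.baseChange K) (lvl M), h1Eval (W.baseChange K) (lvl M) (a + b) ρ = 0 := by
    intro ρ
    have hρ := congrFun h ρ
    rw [Pi.add_apply, rK₁_apply, rK₂_apply, Pi.zero_apply, ← ha, ← hb] at hρ
    rw [← hρ]
    exact map_add (h1EvalHom (W.baseChange K) (lvl M) ρ.2) a b
  -- `σ₀ a = a`, `σ₀ b = -b`
  have hτa : conjAct W (sigmaQ K h2 hθ hθsq) (lvl M) a = a := by
    rw [ha]; exact conjAct_resTorsion K W (lvl M) (sigmaQ K h2 hθ hθsq) h2 hσ₀ s₁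
  have hτb : conjAct W (sigmaQ K h2 hθ hθsq) (lvl M) b = -b := by
    rw [hb, conjAct_hPsiKT W K h2 hθ hθsq (lvl M),
      conjAct_resTorsion K (twin W K) (lvl M) (sigmaQ K h2 hθ hθsq) h2 hσ₀ s₂]
  -- `σ₀ z = z` gives `2b = 0`; `2z = 0` then gives `2a = 0`
  have hfix := hNfix (a + b) hz
  rw [map_add, hτa, hτb] at hfix
  have h2b : (2 : ℤ) • b = 0 := by
    have e : (2 : ℤ) • b = (a + b) - (a + -b) := by rw [two_zsmul]; abel
    rw [e, ← hfix, sub_self]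
  have h2z := hN2 (a + b) hz
  have h2a : (2 : ℤ) • a = 0 := by rwa [zsmul_add, h2b, add_zero] at h2z
  have hu : resTorsion W K (lvl M) ((2 : ℤ) • s₁) = resTorsion W K (lvl M) 0 := by
    rw [map_zsmul, map_zero, ← ha, h2a]
  have hw : resTorsion (twin W K) K (lvl M) ((2 : ℤ) • s₂) = resTorsion (twin W K) K (lvl M) 0 := by
    apply (hPsiKT W K hθ hθsq (lvl M)).injective
    rw [map_zsmul, map_zsmul, map_zero, map_zero, ← hb, h2b]
  exact ⟨resTorsion_injective_of_noTorsion W K h2 hθ hθsq (lvl M) hL hu,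
    resTorsion_twist_injective_of_noTorsion W K h2 hθ hθsq (lvl M) hL hw⟩

/-- **The same with Selmer binders, in the exact shape of a repaired `Input.sel_visible`** (H2′):
`∀ s₁ ∈ Sel(E), ∀ s₂ ∈ Sel(E^{(d_K)}), rK₁ s₁ + rK₂ s₂ = 0 → 2 s₁ = 0 ∧ 2 s₂ = 0`, granted `hNfix`, `hN2`.
[cite: McCallumLMS1991, p. 299] [cite: LawsonWuthrich2016, §7.1 and §8] -/
theorem sel_visible_two_of_kernel_inputs (hs : W.HasSurjectiveModNGaloisRep 2)
    (hNfix : ∀ y : galH1Torsion (W.baseChange K) (lvl M),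
      (∀ ρ : torsionFixing (W.baseChange K) (lvl M), h1Eval (W.baseChange K) (lvl M) y ρ = 0) →
        conjAct W (sigmaQ K h2 hθ hθsq) (lvl M) y = y)
    (hN2 : ∀ y : galH1Torsion (W.baseChange K) (lvl M),
      (∀ ρ : torsionFixing (W.baseChange K) (lvl M), h1Eval (W.baseChange K) (lvl M) y ρ = 0) →
        (2 : ℤ) • y = 0) :
    ∀ s₁ ∈ selmerGroup W (lvl M), ∀ s₂ ∈ selmerGroup (twin W K) (lvl M),
      rK₁ W K M s₁ + rK₂ W M hθ hθsq s₂ = 0 → (2 : ℤ) • s₁ = 0 ∧ (2 : ℤ) • s₂ = 0 :=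
  fun s₁ _ s₂ _ h ↦ two_zsmul_eq_zero_of_rK₁_add_rK₂_eq_zero W K M h2 hθ hθsq hs hNfix hN2 s₁ s₂ h

end Visible

end Summit.BirchSwinnertonDyer.BirchSwinnertonDyer.Theorems.GenusExact.VisiblePairAtTwo

end
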